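/-
Copyright (c) 2026 the pub-hodgecm-mathlib formalisation cell (harness21).  Prover seat hodgecm-mathlib-K2Liu-p02 (g9), Track B «K2-LIT» ∕ hLiu418
#184♮, Road I v3, unit U5 «THE CLOSE», FACE-D₀ rows `hT₁ ∧ hT₂` BY NAME for the dictionary of record (FACE-D₀ desk SIG 2026-09-05T02:13Z, FILE A of the
FACE-D₀ rows assembler).  THEOREMS ONLY.
-/
import Summits.HodgeConjecture.HodgeConjecture.Theorems.K2LiuFourierCoeffDeltaLeviTransport   -- ★ p862708 (K2Liu-p09): `fourierCoeffDelta_rat_siegel_inv_mul` (+ ★ `exists_rat_levi_blocks`)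
import Summits.HodgeConjecture.HodgeConjecture.Theorems.K2LiuSiegelDoubledRationalFrames     -- ★ `exists_rat_siegel_frame₁₁` (a rational Siegel element with prescribed `Δ`-block)
import Summits.HodgeConjecture.HodgeConjecture.Theorems.K2LiuHermitianSkewDictionary          -- ★ p864231 (F0P2-p10): `isUnit_det_gramRL`, `map_gramRL_complexConj`, `transpose_map_reindex`
import HarnessLib

/-!
# K2_Liu road (hLiu418 = stmt-HodgeConjecture-24832), FACE-D₀: THE LEVI-AUTOMORPHY ROWS `hT₁ ∧ hT₂` OF `RigidityRowsOn`, BY NAME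

Cell `pub/hodgecm-mathlib` (D-0151), Track B, build stream 29; helper lane `--supports stmt-HodgeConjecture-24832 --as helper`, count-neutral.

★ p862916 `K2LiuFirstTermIdentityFaceDefs.RigidityRowsOn` :211–:217 asks, for both sides `T₁`, `T₂` of FACE-D₀, for Levi actions `R γ`, `S γ` with
`coeff ((γ^c)ᵀ β γ) ∘ₗ codRestrict P Tᵢ hPᵢ = R γ ∘ₗ (coeff β ∘ₗ codRestrict P Tᵢ hPᵢ) ∘ₗ S γ` for every `γ ∈ GL₂(L)` and every `β`.  With the coefficient family
of record `coeff β = cf (dict β)`, `dict β := δ • (T_L⁻¹ · reindex ρ⁻¹ ρ⁻¹ β)` (★ `K2LiuFirstTermHolCutRows`' DICT clause at F0P2-p10's dictionary ★ p864231), both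
rows follow from K2Liu-p09's ONE transport lemma ★ p862708 `fourierCoeffDelta_rat_siegel_inv_mul` (`φ_S(p⁻¹ h) = φ_{D₀ S A₀⁻¹}(h)` for a rational Siegel `p` with
rational Levi blocks `(A₀, D₀)`, `σ(A₀)ᵀ T_L D₀ = T_L`), at the rational Levi element `p(γ)` of `A₀ := reindex ρ⁻¹ ρ⁻¹ γ⁻¹` (★ `exists_rat_siegel_frame₁₁`):
* §1 `conj_dict_eq` — the index algebra `D₀ · dict β · A₀⁻¹ = dict ((γ^c)ᵀ β γ)` (pure matrix algebra; cancellation of `σ(A₀)ᵀ T_L` on the left and `A₀` on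
  the right).
* §2 **`exists_rat_siegel_dict_transport`** — for `γ ∈ GL₂(L)` a rational Siegel `p` with `φ_{dict ((γ^c)ᵀ β γ)}(h) = φ_{dict β}(p⁻¹ h)` for EVERY continuous
  left-`H(L⁺)`-invariant `φ`, every `β`, every `h`.
* §3 **`exists_leviAction_rows`** — THE TWO ROWS: `∃ R S, ‹hT₁› ∧ ‹hT₂›` (bytes of ★ FaceDefs :211–:217 at generic `D`, `P`, `coeff`, `T₁`, `T₂`) from the DICT
  clauses of both sides and continuity + left-invariance of their values (`T₁`: ★ `AdmissibleOn` (c); `T₂`: ★ p862640), with `R γ := (· ∘ (p(γ)⁻¹ · ))`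
  (`LinearMap.funLeft`) and `S γ := id`.

No definition, no instance, no notation, no named-fact hypothesis, no `sorry`; axioms ⊆ {propext, Classical.choice, Quot.sound}.  HONEST LABEL: HC_CM is proved
only modulo the 7 printed citations (2 remaining named inputs: hLiu418 = stmt-HodgeConjecture-24832, h413 = stmt-HodgeConjecture-24833) until rung 0 closes; this file
moves no counter.

References: [Tan1999] V. Tan, Canad. J. Math. 51 (1999), §3; [MoeglinWaldspurger1995] I.2.6, II.1.7; [HarrisKudlaSweet1996] §1 (1.11)–(1.12);
[KudlaRallis1994] §1 Thm. 1.1, §2; [Shimura1997] §18.1 (18.4).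
-/

set_option autoImplicit false
set_option linter.dupNamespace false

noncomputable section

open scoped Matrix ENNReal
open NumberField IsDedekindDomain MeasureTheory MeasureTheory.Measure
open Literature.NumberTheory.Automorphic Literature.NumberTheory.Automorphic.UnitaryGroup Literature.NumberTheory.GaloisRepresentations
open Literature.NumberTheory.GelbartRogawski1991 Literature.NumberTheory.GelbartRogawski1991.GRConstruction
open Literature.NumberTheory.GelbartRogawski1991.UnitaryDualPair (imagUnit imagUnit_ne_zero)
open Literature.NumberTheory.K2Lit.SiegelDoubled Literature.MeasureTheory.Group

namespace Summit.HodgeConjecture.HodgeConjecture.Cruxes.HLiu418.K2LiuRigidityLeviRows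

open K2LiuSiegelUnipotentFourierDefs K2LiuUnipotentCoveringWeight
open K2LiuSiegelDoubledRationalFrames (exists_rat_siegel_frame₁₁)
open K2LiuSiegelLeviConjUnipDeltaChar (exists_rat_levi_blocks)
open K2LiuFourierCoeffDeltaLeviTransport (fourierCoeffDelta_rat_siegel_inv_mul)
open K2LiuHermitianSkewDictionary (isUnit_det_gramRL map_gramRL_complexConj transpose_map_reindex)

/-! ## §1 The index algebra -/

section Algebra

variable {K : Type*} [Field K] {ι κ : Type*}

/-- square reindexing is multiplicative. [folklore] -/
theorem reindex_mul_reindex [Fintype ι] [Fintype κ] (ρ : ι ≃ κ) (A B : Matrix ι ι K) :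
    Matrix.reindex ρ ρ A * Matrix.reindex ρ ρ B = Matrix.reindex ρ ρ (A * B) := by
  simp only [Matrix.reindex_apply]
  exact Matrix.submatrix_mul_equiv A B ρ.symm ρ.symm ρ.symm

/-- square reindexing maps `1` to `1`. [folklore] -/
theorem reindex_one_sq [DecidableEq ι] [DecidableEq κ] (ρ : ι ≃ κ) : Matrix.reindex ρ ρ (1 : Matrix ι ι K) = 1 := by
  rw [Matrix.reindex_apply, Matrix.submatrix_one_equiv]

/-- **THE INDEX ALGEBRA.**  If `σ(A₀)ᵀ · T · D₀ = T` (the rational Levi relation), `A₀ = reindex ρ⁻¹ ρ⁻¹ γ⁻¹` and `det γ ≠ 0`, then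
`D₀ · (δ • (T⁻¹ · reindex ρ⁻¹ ρ⁻¹ β)) · A₀⁻¹ = δ • (T⁻¹ · reindex ρ⁻¹ ρ⁻¹ ((γ^σ)ᵀ β γ))` — multiply both sides by the units `σ(A₀)ᵀ T` (left) and `A₀` (right); both
become `δ • reindex ρ⁻¹ ρ⁻¹ β`. [cite: HarrisKudlaSweet1996, §1 (1.11)–(1.12)] [cite: Tan1999, §3] -/
theorem conj_dict_eq [Fintype ι] [DecidableEq ι] [Fintype κ] [DecidableEq κ] (σ : K →+* K) {T : Matrix ι ι K} (hT : IsUnit T.det) (δ : K) (ρ : κ ≃ ι)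
    {γ : Matrix κ κ K} (hγ : IsUnit γ.det) {A₀ D₀ : Matrix ι ι K} (hA₀ : A₀ = Matrix.reindex ρ ρ γ⁻¹)
    (hrel : (A₀.map σ)ᵀ * T * D₀ = T) (β : Matrix κ κ K) :
    D₀ * (δ • (T⁻¹ * Matrix.reindex ρ ρ β)) * A₀⁻¹ = δ • (T⁻¹ * Matrix.reindex ρ ρ ((γ.map σ)ᵀ * β * γ)) := by
  -- the two cancelling units `M := σ(A₀)ᵀ T` (left) and `A₀` (right)
  have hA₀det : IsUnit A₀.det := by
    rw [hA₀, Matrix.det_reindex_self]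
    exact Matrix.isUnit_nonsing_inv_det γ hγ
  have hMdet : IsUnit ((A₀.map σ)ᵀ * T).det := by
    rw [Matrix.det_mul, Matrix.det_transpose, ← RingHom.mapMatrix_apply, ← RingHom.map_det]
    exact (hA₀det.map _).mul hT
  have hMu : IsUnit ((A₀.map σ)ᵀ * T) := (Matrix.isUnit_iff_isUnit_det _).2 hMdet
  have hA₀u : IsUnit A₀ := (Matrix.isUnit_iff_isUnit_det _).2 hA₀det
  -- `reindex ρ ρ γ * A₀ = 1` and `σ(A₀)ᵀ * σ(reindex ρ ρ γ)ᵀ = 1`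
  have hγA : Matrix.reindex ρ ρ γ * A₀ = 1 := by
    rw [hA₀, reindex_mul_reindex, Matrix.mul_nonsing_inv γ hγ, reindex_one_sq]
  have hAγσ : (A₀.map σ)ᵀ * ((Matrix.reindex ρ ρ γ).map σ)ᵀ = 1 := by
    rw [← Matrix.transpose_mul, ← Matrix.map_mul, hγA, Matrix.map_one σ (map_zero σ) (map_one σ), Matrix.transpose_one]
  -- cancel on both sides
  refine hMu.mul_left_cancel ?_
  refine hA₀u.mul_right_cancel ?_
  have hL : (A₀.map σ)ᵀ * T * (D₀ * (δ • (T⁻¹ * Matrix.reindex ρ ρ β)) * A₀⁻¹) * A₀ = δ • Matrix.reindex ρ ρ β := by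
    calc (A₀.map σ)ᵀ * T * (D₀ * (δ • (T⁻¹ * Matrix.reindex ρ ρ β)) * A₀⁻¹) * A₀
        = ((A₀.map σ)ᵀ * T * D₀) * (δ • (T⁻¹ * Matrix.reindex ρ ρ β)) * (A₀⁻¹ * A₀) := by
          simp only [Matrix.mul_assoc]
      _ = δ • Matrix.reindex ρ ρ β := by
          rw [hrel, Matrix.nonsing_inv_mul A₀ hA₀det, Matrix.mul_one, Matrix.mul_smul, ← Matrix.mul_assoc, Matrix.mul_nonsing_inv T hT,
            Matrix.one_mul]
  have hR : (A₀.map σ)ᵀ * T * (δ • (T⁻¹ * Matrix.reindex ρ ρ ((γ.map σ)ᵀ * β * γ))) * A₀ = δ • Matrix.reindex ρ ρ β := by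
    calc (A₀.map σ)ᵀ * T * (δ • (T⁻¹ * Matrix.reindex ρ ρ ((γ.map σ)ᵀ * β * γ))) * A₀
        = δ • ((A₀.map σ)ᵀ * (T * T⁻¹) * Matrix.reindex ρ ρ ((γ.map σ)ᵀ * β * γ) * A₀) := by
          simp only [Matrix.mul_smul, Matrix.smul_mul, Matrix.mul_assoc]
      _ = δ • (((A₀.map σ)ᵀ * ((Matrix.reindex ρ ρ γ).map σ)ᵀ) * Matrix.reindex ρ ρ β * (Matrix.reindex ρ ρ γ * A₀)) := by
          rw [Matrix.mul_nonsing_inv T hT, Matrix.mul_one, ← reindex_mul_reindex, ← reindex_mul_reindex, ← transpose_map_reindex]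
          simp only [Matrix.mul_assoc]
      _ = δ • Matrix.reindex ρ ρ β := by rw [hAγσ, hγA, Matrix.one_mul, Matrix.mul_one]
  rw [hL, hR]

end Algebra

/-! ## §2 The transport of the dictionary index under the rational Levi element of `γ` -/

section Transport

variable (L : Type) [Field L] [NumberField L] [IsCMField L]
variable {N M n : ℕ} (e : Fin N × Fin M ≃ Fin n)
  (dV : Fin N → L) (hdV : ∀ i, IsCMField.complexConj L (dV i) = dV i)
  (dW : Fin M → L) (hdW : ∀ i, IsCMField.complexConj L (dW i) = dW i)
variable [MeasurableSpace (unipDelta L e dV hdV dW hdW)] [BorelSpace (unipDelta L e dV hdV dW hdW)]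

/-- **THE DICTIONARY INDEX UNDER THE RATIONAL LEVI.**  For `γ ∈ GL₂(L)` there is a rational Siegel element `p ∈ P_Δ(𝔸) ∩ H(L⁺)` (the Levi element of
`reindex ρ⁻¹ ρ⁻¹ γ⁻¹`, ★ `exists_rat_siegel_frame₁₁`) with `φ_{dict ((γ^c)ᵀ β γ)}(h) = φ_{dict β}(p⁻¹ · h)` for EVERY continuous left-`H(L⁺)`-invariant `φ`, every
`β ∈ M₂(L)` and every `h ∈ H(𝔸)`, where `dict β = δ • (T_L⁻¹ · reindex ρ⁻¹ ρ⁻¹ β)` — ★ p862708 `fourierCoeffDelta_rat_siegel_inv_mul` + ★ `exists_rat_levi_blocks` +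
§1. [cite: Tan1999, §3] [cite: MoeglinWaldspurger1995, I.2.6, II.1.7] [cite: HarrisKudlaSweet1996, §1 (1.11)–(1.12)] -/
theorem exists_rat_siegel_dict_transport (hdV0 : ∀ i, dV i ≠ 0) (hdW0 : ∀ i, dW i ≠ 0)
    (νN : Measure (unipDelta L e dV hdV dW hdW)) [νN.IsHaarMeasure]
    {βw : unipDelta L e dV hdV dW hdW → ℝ≥0∞} (hβ : IsCoveringWeight (unipDeltaRat L e dV hdV dW hdW) βw) (hβtop : ∫⁻ u, βw u ∂νN ≠ ∞)
    (ρ : Fin n ≃ Fin 2) (γ : Matrix (Fin 2) (Fin 2) L) (hγ : IsUnit γ.det) :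
    ∃ p : HA L e dV hdV dW hdW, p ∈ ratH L e dV hdV dW hdW ∧ IsSiegelDelta L e dV hdV dW hdW p ∧
      ∀ (φ : HA L e dV hdV dW hdW → ℂ), Continuous φ →
        (∀ (γ' : ratH L e dV hdV dW hdW) (x : HA L e dV hdV dW hdW), φ ((γ' : HA L e dV hdV dW hdW) * x) = φ x) →
        ∀ (β : Matrix (Fin 2) (Fin 2) L) (h : HA L e dV hdV dW hdW),
          fourierCoeffDelta L e dV hdV dW hdW νN βw
              (imagUnit L • (((gramR L e dV hdV dW hdW).map (algebraMap (Fp L) L))⁻¹ *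
                Matrix.reindex ρ.symm ρ.symm ((γ.map (IsCMField.complexConj L))ᵀ * β * γ))) φ h =
            fourierCoeffDelta L e dV hdV dW hdW νN βw
              (imagUnit L • (((gramR L e dV hdV dW hdW).map (algebraMap (Fp L) L))⁻¹ * Matrix.reindex ρ.symm ρ.symm β)) φ (p⁻¹ * h) := by
  -- the rational `Δ`-block `A := reindex ρ⁻¹ ρ⁻¹ γ⁻¹ ∈ GL_n(L)` and its rational Levi element
  have hAdet : IsUnit (Matrix.reindex ρ.symm ρ.symm γ⁻¹).det := by
    rw [Matrix.det_reindex_self]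
    exact Matrix.isUnit_nonsing_inv_det γ hγ
  have hAu : IsUnit (Matrix.reindex ρ.symm ρ.symm γ⁻¹) := (Matrix.isUnit_iff_isUnit_det _).2 hAdet
  obtain ⟨p, hpr, hpS, b, d, hframe⟩ := exists_rat_siegel_frame₁₁ L e dV hdV dW hdW hdV0 hdW0 hAu.unit
  rw [hAu.unit_spec] at hframe
  obtain ⟨A₀, D₀, hA₀, ha, hd, hrel⟩ := exists_rat_levi_blocks L e dV hdV dW hdW hdV0 hdW0 hpS hpr
  -- `A₀ = A`: both are the `Δ`-block of `p`, read rationally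
  have hA₀A : A₀ = Matrix.reindex ρ.symm ρ.symm γ⁻¹ := by
    have h1 : A₀.map (algebraMap L (AdeleRing (𝓞 L) L)) = (Matrix.reindex ρ.symm ρ.symm γ⁻¹).map (algebraMap L (AdeleRing (𝓞 L) L)) := by
      rw [← ha, deltaBlock_eq_conj, hframe, Matrix.toBlocks_fromBlocks₁₁]
    haveI : Nontrivial (AdeleRing (𝓞 L) L) := inferInstanceAs (Nontrivial (InfiniteAdeleRing L × FiniteAdeleRing (𝓞 L) L))
    exact Matrix.ext fun i j => (algebraMap L (AdeleRing (𝓞 L) L)).injective (congrFun (congrFun h1 i) j)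
  refine ⟨p, hpr, hpS, fun φ hφc hφγ β h => ?_⟩
  rw [fourierCoeffDelta_rat_siegel_inv_mul L e dV hdV dW hdW hdV0 hdW0 νN hβ hβtop hpS hpr hA₀ ha hd _ hφc hφγ h,
    conj_dict_eq ((IsCMField.complexConj L : L ≃ₐ[Fp L] L) : L →+* L) (isUnit_det_gramRL L e dV hdV dW hdW hdV0 hdW0) (imagUnit L) ρ.symm hγ hA₀A
      hrel β]
  rfl

end Transport

/-! ## §3 The rows `hT₁ ∧ hT₂` of `RigidityRowsOn` -/

section Rows

variable (L : Type) [Field L] [NumberField L] [IsCMField L]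
variable {N M n : ℕ} (e : Fin N × Fin M ≃ Fin n)
  (dV : Fin N → L) (hdV : ∀ i, IsCMField.complexConj L (dV i) = dV i)
  (dW : Fin M → L) (hdW : ∀ i, IsCMField.complexConj L (dW i) = dW i)
variable [MeasurableSpace (unipDelta L e dV hdV dW hdW)] [BorelSpace (unipDelta L e dV hdV dW hdW)]

/-- **THE LEVI-AUTOMORPHY ROWS `hT₁ ∧ hT₂` OF FACE-D₀** (★ `K2LiuFirstTermIdentityFaceDefs.RigidityRowsOn` :211–:217, bytes at generic `D`, `P`, `coeff`): for two
linear maps `T₁ T₂ : D →ₗ (H(𝔸) → ℂ)` with continuous left-`H(L⁺)`-invariant values (`T₁`: ★ `AdmissibleOn` clause (c); `T₂`: ★ p862640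
`continuous_thetaFunctional` ∕ `thetaFunctional_ratH_mul`), a class `P ∋ Tᵢ x` and a coefficient family `coeff` whose composites with `codRestrict P Tᵢ` READ
the Fourier coefficient at the dictionary index (`hdict₁`, `hdict₂` — ★ `K2LiuFirstTermHolCutRows.holCutRows_of_descentLetters`' DICT₁ ∕ DICT₂ at F0P2-p10's
dictionary), there are `R`, `S` with both rows; `R γ :=` precomposition with `p(γ)⁻¹ · ` (§2), `S γ := id`.
[cite: Tan1999, §3] [cite: MoeglinWaldspurger1995, II.1.7] [cite: KudlaRallis1994, §1 Thm. 1.1] -/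
theorem exists_leviAction_rows (hdV0 : ∀ i, dV i ≠ 0) (hdW0 : ∀ i, dW i ≠ 0)
    (νN : Measure (unipDelta L e dV hdV dW hdW)) [νN.IsHaarMeasure]
    {βw : unipDelta L e dV hdV dW hdW → ℝ≥0∞} (hβ : IsCoveringWeight (unipDeltaRat L e dV hdV dW hdW) βw) (hβtop : ∫⁻ u, βw u ∂νN ≠ ∞)
    (ρ : Fin n ≃ Fin 2) {D : Type*} [AddCommGroup D] [Module ℂ D]
    (T₁ T₂ : D →ₗ[ℂ] (HA L e dV hdV dW hdW → ℂ)) (P : Submodule ℂ (HA L e dV hdV dW hdW → ℂ)) (hP₁ : ∀ x, T₁ x ∈ P) (hP₂ : ∀ x, T₂ x ∈ P)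
    (coeff : Matrix (Fin 2) (Fin 2) L → ↥P →ₗ[ℂ] (HA L e dV hdV dW hdW → ℂ))
    (hdict₁ : ∀ (β : Matrix (Fin 2) (Fin 2) L) (x : D) (h : HA L e dV hdV dW hdW),
      (coeff β ∘ₗ LinearMap.codRestrict P T₁ hP₁) x h = fourierCoeffDelta L e dV hdV dW hdW νN βw
        (imagUnit L • (((gramR L e dV hdV dW hdW).map (algebraMap (Fp L) L))⁻¹ * Matrix.reindex ρ.symm ρ.symm β)) (T₁ x) h)
    (hdict₂ : ∀ (β : Matrix (Fin 2) (Fin 2) L) (x : D) (h : HA L e dV hdV dW hdW),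
      (coeff β ∘ₗ LinearMap.codRestrict P T₂ hP₂) x h = fourierCoeffDelta L e dV hdV dW hdW νN βw
        (imagUnit L • (((gramR L e dV hdV dW hdW).map (algebraMap (Fp L) L))⁻¹ * Matrix.reindex ρ.symm ρ.symm β)) (T₂ x) h)
    (hc₁ : ∀ x, Continuous (T₁ x))
    (hrat₁ : ∀ x (γ' : ratH L e dV hdV dW hdW) (h : HA L e dV hdV dW hdW), T₁ x ((γ' : HA L e dV hdV dW hdW) * h) = T₁ x h)
    (hc₂ : ∀ x, Continuous (T₂ x))
    (hrat₂ : ∀ x (γ' : ratH L e dV hdV dW hdW) (h : HA L e dV hdV dW hdW), T₂ x ((γ' : HA L e dV hdV dW hdW) * h) = T₂ x h) :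
    ∃ (R : Matrix (Fin 2) (Fin 2) L → (HA L e dV hdV dW hdW → ℂ) →ₗ[ℂ] (HA L e dV hdV dW hdW → ℂ)) (S : Matrix (Fin 2) (Fin 2) L → D →ₗ[ℂ] D),
      (∀ γ : Matrix (Fin 2) (Fin 2) L, IsUnit γ.det → ∀ β : Matrix (Fin 2) (Fin 2) L,
        coeff ((γ.map (IsCMField.complexConj L))ᵀ * β * γ) ∘ₗ LinearMap.codRestrict P T₁ hP₁ =
          R γ ∘ₗ (coeff β ∘ₗ LinearMap.codRestrict P T₁ hP₁) ∘ₗ S γ) ∧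
      (∀ γ : Matrix (Fin 2) (Fin 2) L, IsUnit γ.det → ∀ β : Matrix (Fin 2) (Fin 2) L,
        coeff ((γ.map (IsCMField.complexConj L))ᵀ * β * γ) ∘ₗ LinearMap.codRestrict P T₂ hP₂ =
          R γ ∘ₗ (coeff β ∘ₗ LinearMap.codRestrict P T₂ hP₂) ∘ₗ S γ) := by
  classical
  -- the rational Levi element of each `γ ∈ GL₂(L)` (§2), chosen once
  choose p _hpr _hpS hp using fun γ : {γ : Matrix (Fin 2) (Fin 2) L // IsUnit γ.det} =>
    exists_rat_siegel_dict_transport L e dV hdV dW hdW hdV0 hdW0 νN hβ hβtop ρ γ.1 γ.2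
  refine ⟨fun γ => if hγ : IsUnit γ.det then LinearMap.funLeft ℂ ℂ (fun h : HA L e dV hdV dW hdW => (p ⟨γ, hγ⟩)⁻¹ * h) else 0,
    fun _ => LinearMap.id, fun γ hγ β => ?_, fun γ hγ β => ?_⟩
  · refine LinearMap.ext fun x => funext fun h => ?_
    rw [hdict₁, LinearMap.comp_apply, LinearMap.comp_apply, LinearMap.id_apply]
    simp only [dif_pos hγ, LinearMap.funLeft_apply]
    rw [hdict₁]
    exact hp ⟨γ, hγ⟩ (T₁ x) (hc₁ x) (fun γ' y => hrat₁ x γ' y) β h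
  · refine LinearMap.ext fun x => funext fun h => ?_
    rw [hdict₂, LinearMap.comp_apply, LinearMap.comp_apply, LinearMap.id_apply]
    simp only [dif_pos hγ, LinearMap.funLeft_apply]
    rw [hdict₂]
    exact hp ⟨γ, hγ⟩ (T₂ x) (hc₂ x) (fun γ' y => hrat₂ x γ' y) β h

end Rows

end Summit.HodgeConjecture.HodgeConjecture.Cruxes.HLiu418.K2LiuRigidityLeviRows

end
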